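import Mathlib

/-!
# Ladder duality `isLadder_reverse` via sumset / difference-set normal forms (siege attempt k23)

Item `stmt-MatrixMultiplication-14308` (`FourierTwoFamiliesModP.PrimeTwoFamilies`, CKSU 2005
Conj. 4.7 with prime cyclic hosts), line `Sketch`, registered stub `isLadder_reverse`
(variation: reduce to lemmas, then assemble).

A LADDER is an ordered family `(X c, Y c)_{c < r}` of finite subsets of an additive commutative
group with

* (W) every class direct: `(x - x') + (y - y') = 0` with `x, x' ∈ X c`, `y, y' ∈ Y c` forces
  `x = x'` and `y = y'`;
* (L) one-directional separation: for `p < q` the lower cross differences `y' - x'`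
  (`x' ∈ X p`, `y' ∈ Y q`) avoid every diagonal difference `y - x` (`x ∈ X c`, `y ∈ Y c`).

The stub: the family `c ↦ (Y (Fin.rev c), X (Fin.rev c))` (swap the two sides, reverse the class
order) is again a ladder.

Route taken here (a third proof, sharing no code with the two element-chasing proofs in the tree,
`…Theorems.PrimeTwoFamilies.LadderLift.isLadder_reverse` and
`…Theorems.PrimeTwoFamilies.LadderReverseK14.isLadder_reverse`): both clauses are first put into
the SET-LEVEL normal forms in which the line's packing and shape lemmas are phrased, and in which
the duality is a visible symmetry of the normal form; the registered signature is then assembled.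

* `direct_iff_sub_inter_sub` — (W) for one class `(S, T)` holds iff `(S - S) ∩ (T - T) ⊆ {0}`
  (the classical criterion for the sum `S + T` to be direct).  This is symmetric under `S ↔ T`
  by `Finset.inter_comm`.
* `sep_iff_disjoint_add` — (L) holds iff for every class `c` and every pair `p < q` the sumsets
  `X p + Y c` and `X c + Y q` are DISJOINT (a coincidence of differences `y - x = y' - x'` is the
  cross-sum coincidence `x' + y = x + y'`).  For the dual family the disjointness required at
  `(c, p, q)` becomes, after `add_comm` inside each sumset and `Disjoint.symm`, literally the
  original one at `(Fin.rev c, Fin.rev q, Fin.rev p)`, and `Fin.rev_lt_rev` supplies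
  `Fin.rev q < Fin.rev p` from `p < q`.

Mathlib only; no new definitions (the clauses stay inlined exactly as registered); the
`DecidableEq` instance needed for the pointwise operations is taken classically INSIDE the proof
of `isLadder_reverse`, so the registered signature is unchanged.
-/

-- single-conjunct summit: the mandated namespace repeats `MatrixMultiplication` (summit = sub-problem).
set_option linter.dupNamespace false

namespace Summit.MatrixMultiplication.MatrixMultiplication.Theorems.PrimeTwoFamilies.LadderReverseK23

open Finset
open scoped Pointwise

section NormalForms

variable {G : Type*} [AddCommGroup G] [DecidableEq G]

/-- **Normal form of directness (W).**  A class `(S, T)` is direct — `(x - x') + (y - y') = 0`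
with `x, x' ∈ S`, `y, y' ∈ T` forces `x = x'` and `y = y'` — iff the difference sets meet only
in `0`: `(S - S) ∩ (T - T) ⊆ {0}` [folklore: `S + T` is a direct sum iff `(S - S) ∩ (T - T) = {0}`].
The right-hand side is symmetric in `S`, `T` (`Finset.inter_comm`). -/
theorem direct_iff_sub_inter_sub (S T : Finset G) :
    (∀ x ∈ S, ∀ x' ∈ S, ∀ y ∈ T, ∀ y' ∈ T, (x - x') + (y - y') = 0 → x = x' ∧ y = y') ↔
      (S - S) ∩ (T - T) ⊆ {0} := by
  constructor
  · intro h d hd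
    rw [mem_inter, mem_sub, mem_sub] at hd
    obtain ⟨⟨x, hx, x', hx', rfl⟩, ⟨t₁, ht₁, t₂, ht₂, ht⟩⟩ := hd
    -- `ht : t₁ - t₂ = x - x'`; directness at `(x, x', t₂, t₁)` forces `x = x'`.
    have key := h x hx x' hx' t₂ ht₂ t₁ ht₁ (by rw [← ht]; abel)
    rw [mem_singleton, key.1, sub_self]
  · intro h x hx x' hx' y hy y' hy' h0
    -- `x - x' = y' - y` is a common difference, hence `0`.
    have h1 : x - x' = y' - y := (eq_neg_of_add_eq_zero_left h0).trans (neg_sub y y')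
    have hd : x - x' ∈ (S - S) ∩ (T - T) := by
      rw [mem_inter]
      refine ⟨sub_mem_sub hx hx', ?_⟩
      rw [h1]
      exact sub_mem_sub hy' hy
    have hx0 : x - x' = 0 := mem_singleton.1 (h hd)
    refine ⟨sub_eq_zero.1 hx0, ?_⟩
    rw [hx0, zero_add, sub_eq_zero] at h0
    exact h0

variable {r : ℕ}

/-- **Normal form of one-directional separation (L).**  For a family `(X c, Y c)_{c < r}`, the
clause "for `p < q`, every cross difference `y' - x'` (`x' ∈ X p`, `y' ∈ Y q`) differs from every
diagonal difference `y - x` (`x ∈ X c`, `y ∈ Y c`)" holds iff for every `c` and every `p < q` the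
sumsets `X p + Y c` and `X c + Y q` are disjoint: `y - x = y' - x'` is the cross-sum coincidence
`x' + y = x + y'` (`sub_eq_sub_iff_add_eq_add`) [folklore]. -/
theorem sep_iff_disjoint_add (X Y : Fin r → Finset G) :
    (∀ c p q : Fin r, p < q → ∀ x ∈ X c, ∀ y ∈ Y c, ∀ x' ∈ X p, ∀ y' ∈ Y q, y - x ≠ y' - x') ↔
      ∀ c p q : Fin r, p < q → Disjoint (X p + Y c) (X c + Y q) := by
  refine forall₃_congr fun c p q => imp_congr_right fun _ => ?_
  rw [Finset.disjoint_left]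
  constructor
  · intro h s hs hs'
    rw [mem_add] at hs hs'
    obtain ⟨x', hx', y, hy, rfl⟩ := hs
    obtain ⟨x, hx, y', hy', he⟩ := hs'
    -- `he : x + y' = x' + y`, i.e. the forbidden coincidence `y - x = y' - x'`.
    refine h x hx y hy x' hx' y' hy' ?_
    rw [sub_eq_sub_iff_add_eq_add, add_comm y x', add_comm y' x]
    exact he.symm
  · intro h x hx y hy x' hx' y' hy' he
    -- `he : y - x = y' - x'` puts `x' + y = x + y'` into both sumsets.
    rw [sub_eq_sub_iff_add_eq_add, add_comm y x', add_comm y' x] at he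
    exact h (add_mem_add hx' hy) (he ▸ add_mem_add hx hy')

end NormalForms

/-- **Ladder duality** (registered stub `isLadder_reverse` of crux `PrimeTwoFamilies`, line
`Sketch`).  If `(X c, Y c)_{c < r}` is a ladder — every class direct (`hW`) and one-directionally
separated (`hL`) — then so is the family obtained by swapping the two sides and reversing the
class order, `c ↦ (Y (Fin.rev c), X (Fin.rev c))`.

Assembly from the normal forms: directness of the swapped class `(Y (Fin.rev c), X (Fin.rev c))`
is `direct_iff_sub_inter_sub` read through `Finset.inter_comm`; separation of the dual family at
`(c, p, q)` is, in the sumset form `sep_iff_disjoint_add` and after `add_comm` in each sumset, the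
`Disjoint.symm` of the original separation at `(Fin.rev c, Fin.rev q, Fin.rev p)`, where
`Fin.rev q < Fin.rev p` is `Fin.rev_lt_rev`. -/
theorem isLadder_reverse {G : Type*} [AddCommGroup G] {r : ℕ} (X Y : Fin r → Finset G)
    (hW : ∀ c : Fin r, ∀ x ∈ X c, ∀ x' ∈ X c, ∀ y ∈ Y c, ∀ y' ∈ Y c,
      (x - x') + (y - y') = 0 → x = x' ∧ y = y')
    (hL : ∀ c p q : Fin r, p < q → ∀ x ∈ X c, ∀ y ∈ Y c, ∀ x' ∈ X p, ∀ y' ∈ Y q,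
      y - x ≠ y' - x') :
    (∀ c : Fin r, ∀ x ∈ Y (Fin.rev c), ∀ x' ∈ Y (Fin.rev c), ∀ y ∈ X (Fin.rev c),
        ∀ y' ∈ X (Fin.rev c), (x - x') + (y - y') = 0 → x = x' ∧ y = y') ∧
    (∀ c p q : Fin r, p < q → ∀ x ∈ Y (Fin.rev c), ∀ y ∈ X (Fin.rev c),
        ∀ x' ∈ Y (Fin.rev p), ∀ y' ∈ X (Fin.rev q), y - x ≠ y' - x') := by
  classical
  refine ⟨fun c => ?_, ?_⟩
  · -- (W): the normal form is symmetric in the two sides.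
    rw [direct_iff_sub_inter_sub, inter_comm]
    exact (direct_iff_sub_inter_sub _ _).1 (hW (Fin.rev c))
  · -- (L): sumset form, commute each sumset, flip the disjointness, reverse the order.
    refine (sep_iff_disjoint_add (fun c => Y (Fin.rev c)) (fun c => X (Fin.rev c))).2
      fun c p q hpq => ?_
    show Disjoint (Y (Fin.rev p) + X (Fin.rev c)) (Y (Fin.rev c) + X (Fin.rev q))
    rw [add_comm (Y (Fin.rev p)), add_comm (Y (Fin.rev c))]
    exact ((sep_iff_disjoint_add X Y).1 hL (Fin.rev c) (Fin.rev q) (Fin.rev p)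
      (Fin.rev_lt_rev.2 hpq)).symm

end Summit.MatrixMultiplication.MatrixMultiplication.Theorems.PrimeTwoFamilies.LadderReverseK23
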